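import Summits.RiemannHypothesis.RiemannHypothesis.Theses.OddSector
import Summits.RiemannHypothesis.RiemannHypothesis.Theorems.OddSectorOddOneSignedWindowsExistence
import Summits.RiemannHypothesis.RiemannHypothesis.Theorems.OddSectorOddOneSignedWindowsEnergyFloorCore
import Summits.RiemannHypothesis.RiemannHypothesis.Theorems.OddSectorOddOneSignedWindowsTwoLevelProximity
import Summits.RiemannHypothesis.RiemannHypothesis.Theorems.OddSectorOddOneSignedWindowsNonResonantCofinal
import Summits.RiemannHypothesis.RiemannHypothesis.Theorems.OddSectorOddOneSignedWindowsTightBlockNonneg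
import Summits.RiemannHypothesis.RiemannHypothesis.Theorems.OddSectorOddOneSignedWindowsProximityOfTight
import Literature.NumberTheory.LFunctions.WeilOddGroundState
import HarnessLib

/-!
# Skeleton v4 — crux `OddSector.OddOneSignedWindows` (stmt-RiemannHypothesis-17778), line `SketchIdeator5`
(crux-ideate r2-k5, card `prolate-seed-sign-from-energy`; registered skeleton of lead a1, 2026-08-17; v4 after wave 2 + lead's numerics)

The card's thesis: in Connes' `𝓔`-seed coordinates the SIGN of the odd bottom state is decided by RH-free
structure, so one-signedness at a non-resonant window follows from a two-sided RELATIVE ENERGY statement (`Tight`)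
comparing the two lowest odd levels with the explicit odd prolate block (rungs `6, 10, …, 4K+2`, Slepian
parameter `2πe^{2a}`). Typing sketch: crux-dir `SketchIdeator5.lean`. Every stub is stated over tree vocabulary
only; the card's predicates are inlined as a `let`-tower (`IsSincEigen` / `IsSeed` / `IsVec` / `IsTest` /
`IsELB` / `Tight`) so that stub files land `--supports` without a Defs file.

WAVE 1 (landed, imported above, used by name): `stub_twoLevelProximity` (P1, p164061),
`stub_nonResonantCofinal` (P3, p163602), `stub_tightBlockNonneg` (C, p163579 — certificate that clause (i) of
the v1 `Tight` alone forces `0 ≤ ε_od(a)`; superseded in the composition by clause (o) below but kept in tree).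

RESHAPE v1 → v2 (worker W4 `stub-misstated` on K2, adopted): clause (ii) of `Tight` put the gap on the
orthocomplement of the WHOLE block (codimension `K`), which for `K ≥ 2` yields no second-level bound `m₂ > ε_od`
on `u^⊥` — the premise of two-level proximity, the card's only bulk mechanism (abstract witness: a doubly
degenerate odd bottom `ε₁ = ε₂ < ε₃` with block span ≈ the bottom eigenspace passes (i) and (ii) yet need not
contain a one-signed vector). v2 `Tight θ Δ K a` := (o) `0 < ε_od(a)` ∧ ∃ odd prolate block `v` with
(i) [verbatim] every admissible energy lower bound `R` of the unit vectors of the block span has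
`R/(1+θe^{-4a}) ≤ Re Q(h)` on the odd unit test sphere ∧ (ii') RELATIVE ODD GAP: `∃ z ∈ L²` with
`Re Q ≥ (1+Δ)ε_od(a)` on the odd unit tests orthogonal to `z`. Also `IsVec` now records `MemLp v 2` (true for the
intended vector; spares the measurability of the PSWF composite). The shape theorem is split at skeleton level:
K2a `stub_proximityOfTight` (RH-free, provable: sup of admissible `R` + gap transfer `z → u` by the weak
Euler–Lagrange identity + P1 along a recovery sequence ⇒ some unit vector of the block span is `L²`-close to the
ground state: `1 − |⟨u,w⟩|² ≤ 2θe^{-4a}/Δ`) and K2b `stub_signFromEnergy` (the sign from that proximity — XL,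
needs interior regularity / odd spectrum with edge traces + Hadamard / PSWF uniqueness and profile bounds, none
in tree: worker inventory `work/stubs/SignFromEnergy-inventory.md`).

WAVE 2: `stub_proximityOfTight` (K2a) LANDED p165937 (with reusable `gapTransfer`, `proximityOfTight`).

Stubs (sorries only here): `stub_signFromEnergy` (K2b, RH-free intent, XL/blocked — inventory), `stub_tightBlockEventually`
(K1, RH-STRENGTH, lead). Composition `OddOneSignedWindows_of` concludes the
crux BY NAME; `riemannHypothesis_of_stubs` is the strength certificate K1 ⇒ RH (clause (o) + P3 + antitonicity).
-/

noncomputable section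

set_option linter.dupNamespace false

open Complex Filter Set MeasureTheory
open scoped Real Topology

namespace Summit.RiemannHypothesis.RiemannHypothesis.Theorems.OddSector

open Literature.NumberTheory.LFunctions
open Summit.RiemannHypothesis.RiemannHypothesis.Theses.OddSector (OddOneSignedWindows)

-- `stub_twoLevelProximity` (P1), `stub_nonResonantCofinal` (P3), `stub_tightBlockNonneg` (C) LANDED in wave 1
-- (imported above; P1 and P3 are used by name in the composition below).

-- `stub_proximityOfTight` (K2a) LANDED in wave 2 (p165937, …ProximityOfTight.lean; imported above, used by name below).

/-- **K2a, v4 form, from the landed wave-2 lemma (no stub).** For the v4 `Tight` (fixed relative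
tightness `θ₀`, growing relative odd gap `Δ₀e^{4a}`), two-level proximity (P1) yields a unit vector `w` of the
block span with `1 − |⟨u,w⟩|² ≤ 2θ₀e^{-4a}/Δ₀`: instantiate the landed `proximityOfTight` (p165937) at
`θ := θ₀e^{4a}`, `Δ := Δ₀e^{4a}`. -/
theorem proximityOfTight_v4 :
    let IsSincEigen : ℝ → ℕ → (ℝ → ℝ) → ℝ → Prop := fun c k ψ μ =>
      ContinuousOn ψ (Icc (-1) 1) ∧ (∀ x, ψ (-x) = ψ x) ∧ (∫ x in Icc (-1 : ℝ) 1, ψ x ^ 2 = 1) ∧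
        (∀ x ∈ Icc (-1 : ℝ) 1, ∫ y in Icc (-1 : ℝ) 1,
          (if x = y then c / Real.pi else Real.sin (c * (x - y)) / (Real.pi * (x - y))) * ψ y =
            μ * ψ x) ∧
        {x : ℝ | x ∈ Ioo (0 : ℝ) 1 ∧ ψ x = 0}.ncard = k ∧ {x : ℝ | x ∈ Ioo (0 : ℝ) 1 ∧ ψ x = 0}.Finite
    let IsSeed : ℝ → ℕ → (ℝ → ℝ) → Prop := fun lam m φ =>
      ∃ (ψ₁ ψ : ℝ → ℝ) (μ₁ μ : ℝ), IsSincEigen (2 * Real.pi * lam ^ 2) 1 ψ₁ μ₁ ∧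
        IsSincEigen (2 * Real.pi * lam ^ 2) (2 * m + 1) ψ μ ∧
        ∀ y, φ y = if |y| ≤ lam then ψ (y / lam) * ψ₁ 0 - ψ₁ (y / lam) * ψ 0 else 0
    let IsVec : ℝ → ℕ → (ℝ → ℂ) → Prop := fun a m v =>
      ∃ (φ : ℝ → ℝ) (N : ℝ), IsSeed (Real.exp a) m φ ∧ 0 < N ∧ MemLp v 2 ∧
        (∀ t, v t = if |t| ≤ a then
          (((N / 2) * (Real.exp (t / 2) * ∑' n : ℕ, φ ((n + 1 : ℕ) * Real.exp t) -
            Real.exp (-t / 2) * ∑' n : ℕ, φ ((n + 1 : ℕ) * Real.exp (-t))) : ℝ) : ℂ) else 0) ∧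
        ∫ t, ‖v t‖ ^ 2 = (1 : ℝ)
    let IsTest : ℝ → (ℝ → ℂ) → Prop := fun a h =>
      IsWeilTest h ∧ tsupport h ⊆ Icc (-a) a ∧ (∀ t, h (-t) = -h t) ∧ ∫ t, ‖h t‖ ^ 2 = (1 : ℝ)
    let IsELB : ℝ → (ℝ → ℂ) → ℝ → Prop := fun a w R =>
      ∀ g : ℕ → ℝ → ℂ, (∀ n, IsTest a (g n)) →
        Tendsto (fun n => ∫ t, ‖g n t - w t‖ ^ 2) atTop (𝓝 0) →
          ∀ δ : ℝ, 0 < δ → ∀ᶠ n in atTop, R - δ ≤ (weilQuadratic (g n)).re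
    let Tight : ℝ → ℝ → ℕ → ℝ → Prop := fun θ₀ Δ₀ K a =>
      0 < weilOddGroundEnergy a ∧
      ∃ v : Fin K → ℝ → ℂ, (∀ i : Fin K, IsVec a ((i : ℕ) + 1) (v i)) ∧
        (∀ R : ℝ, (∀ c : Fin K → ℂ, (∫ t, ‖∑ i, c i * v i t‖ ^ 2 = (1 : ℝ)) →
            IsELB a (fun t => ∑ i, c i * v i t) R) →
          ∀ h : ℝ → ℂ, IsTest a h → R / (1 + θ₀) ≤ (weilQuadratic h).re) ∧
        (∃ z : ℝ → ℂ, MemLp z 2 ∧ ∀ h : ℝ → ℂ, IsTest a h →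
          ∫ t, (starRingEnd ℂ) (z t) * h t = 0 →
            (1 + Δ₀ * Real.exp (4 * a)) * weilOddGroundEnergy a ≤ (weilQuadratic h).re)
    (∀ (a : ℝ) (u : ℝ → ℂ), IsWeilOddGroundState a u →
      ∀ m₂ : ℝ, weilOddGroundEnergy a < m₂ →
        (∀ h : ℝ → ℂ, IsWeilTest h → tsupport h ⊆ Icc (-a) a → (∀ t, h (-t) = -h t) →
          ∫ t, ‖h t‖ ^ 2 = (1 : ℝ) → ∫ t, (starRingEnd ℂ) (u t) * h t = 0 →
            m₂ ≤ (weilQuadratic h).re) →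
        ∀ v : ℝ → ℂ, IsWeilTest v → tsupport v ⊆ Icc (-a) a → (∀ t, v (-t) = -v t) →
          ∫ t, ‖v t‖ ^ 2 = (1 : ℝ) →
            1 - ‖∫ t, (starRingEnd ℂ) (u t) * v t‖ ^ 2 ≤
              ((weilQuadratic v).re - weilOddGroundEnergy a) / (m₂ - weilOddGroundEnergy a)) →
    ∀ (θ₀ Δ₀ : ℝ) (K : ℕ) (a : ℝ) (u : ℝ → ℂ), 0 < θ₀ → 0 < Δ₀ → Tight θ₀ Δ₀ K a →
      IsWeilOddGroundState a u →
        ∃ v : Fin K → ℝ → ℂ, (∀ i : Fin K, IsVec a ((i : ℕ) + 1) (v i)) ∧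
          ∃ c : Fin K → ℂ, (∫ t, ‖∑ i, c i * v i t‖ ^ 2 = (1 : ℝ)) ∧
            1 - ‖∫ t, (starRingEnd ℂ) (u t) * ∑ i, c i * v i t‖ ^ 2 ≤
              2 * θ₀ * Real.exp (-4 * a) / Δ₀ := by
  intro IsSincEigen IsSeed IsVec IsTest IsELB Tight hP1 θ₀ Δ₀ K a u hθ₀ hΔ₀ hT hu
  obtain ⟨hε, v, hv, hRi, hgap⟩ := hT
  have hvm : ∀ i, MemLp (v i) 2 := fun i => by
    obtain ⟨φ, N, -, -, hm, -⟩ := hv i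
    exact hm
  have hθ : 0 < θ₀ * Real.exp (4 * a) := mul_pos hθ₀ (Real.exp_pos _)
  have hΔ : 0 < Δ₀ * Real.exp (4 * a) := mul_pos hΔ₀ (Real.exp_pos _)
  have hexp : Real.exp (4 * a) * Real.exp (-4 * a) = 1 := by
    rw [← Real.exp_add]; norm_num
  have key : θ₀ * Real.exp (4 * a) * Real.exp (-4 * a) = θ₀ := by
    rw [mul_assoc, hexp, mul_one]
  have hRi' : ∀ R : ℝ,
      (∀ c : Fin K → ℂ, (∫ t, ‖∑ i, c i * v i t‖ ^ 2 = (1 : ℝ)) →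
        ∀ g : ℕ → ℝ → ℂ, (∀ n, IsWeilTest (g n) ∧ tsupport (g n) ⊆ Icc (-a) a ∧
            (∀ t, g n (-t) = -g n t) ∧ ∫ t, ‖g n t‖ ^ 2 = (1 : ℝ)) →
          Tendsto (fun n => ∫ t, ‖g n t - ∑ i, c i * v i t‖ ^ 2) atTop (𝓝 0) →
            ∀ δ : ℝ, 0 < δ → ∀ᶠ n in atTop, R - δ ≤ (weilQuadratic (g n)).re) →
      ∀ h : ℝ → ℂ, IsWeilTest h ∧ tsupport h ⊆ Icc (-a) a ∧ (∀ t, h (-t) = -h t) ∧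
        ∫ t, ‖h t‖ ^ 2 = (1 : ℝ) →
          R / (1 + θ₀ * Real.exp (4 * a) * Real.exp (-4 * a)) ≤ (weilQuadratic h).re := by
    rw [key]
    exact hRi
  obtain ⟨c, hc, hprox⟩ := proximityOfTight hθ hΔ hu hε hvm (hP1 a u hu) hRi' hgap
  refine ⟨v, hv, c, hc, hprox.trans_eq ?_⟩
  have hE : Real.exp (4 * a) ≠ 0 := (Real.exp_pos _).ne'
  have hneg : Real.exp (-4 * a) = (Real.exp (4 * a))⁻¹ := by
    rw [show (-4 * a) = -(4 * a) by ring, Real.exp_neg]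
  rw [hneg]
  field_simp

/-- **Stub K2b — the shape theorem `SignFromEnergy` (RH-free in intent, XL: blocked on theory absent from the
tree).** Granting P1 and K2a (hypotheses), for every block size `K ≥ 1`, `θ, Δ, r > 0` there is a height `A`
beyond which every window at distance `≥ r e^{-2a}` from `log ℕ_{≥2}` that is `Tight` is GOOD (carries an odd
ground state real and `≥ 0` a.e. on `(0,a)`). Card's plan: bulk from the `L²`-proximity of K2a + interior `L^∞`
regularity of the odd Euler–Lagrange equation; origin by the landed origin-layer lemma (p151407) + Poisson; edge
by the rung-admixture bound (Hadamard `c₊(u_k)² = −ε_k′/2` for all odd levels) + the local archimedean layer +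
uniform PSWF bounds for the explicit block. Inventory of the missing facts: `work/stubs/SignFromEnergy-inventory.md`
(lead folder) — most load-bearing: the Hadamard/edge-trace formula for odd levels; none is in tree or Mathlib. -/
theorem stub_signFromEnergy :
    let IsSincEigen : ℝ → ℕ → (ℝ → ℝ) → ℝ → Prop := fun c k ψ μ =>
      ContinuousOn ψ (Icc (-1) 1) ∧ (∀ x, ψ (-x) = ψ x) ∧ (∫ x in Icc (-1 : ℝ) 1, ψ x ^ 2 = 1) ∧
        (∀ x ∈ Icc (-1 : ℝ) 1, ∫ y in Icc (-1 : ℝ) 1,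
          (if x = y then c / Real.pi else Real.sin (c * (x - y)) / (Real.pi * (x - y))) * ψ y =
            μ * ψ x) ∧
        {x : ℝ | x ∈ Ioo (0 : ℝ) 1 ∧ ψ x = 0}.ncard = k ∧ {x : ℝ | x ∈ Ioo (0 : ℝ) 1 ∧ ψ x = 0}.Finite
    let IsSeed : ℝ → ℕ → (ℝ → ℝ) → Prop := fun lam m φ =>
      ∃ (ψ₁ ψ : ℝ → ℝ) (μ₁ μ : ℝ), IsSincEigen (2 * Real.pi * lam ^ 2) 1 ψ₁ μ₁ ∧
        IsSincEigen (2 * Real.pi * lam ^ 2) (2 * m + 1) ψ μ ∧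
        ∀ y, φ y = if |y| ≤ lam then ψ (y / lam) * ψ₁ 0 - ψ₁ (y / lam) * ψ 0 else 0
    let IsVec : ℝ → ℕ → (ℝ → ℂ) → Prop := fun a m v =>
      ∃ (φ : ℝ → ℝ) (N : ℝ), IsSeed (Real.exp a) m φ ∧ 0 < N ∧ MemLp v 2 ∧
        (∀ t, v t = if |t| ≤ a then
          (((N / 2) * (Real.exp (t / 2) * ∑' n : ℕ, φ ((n + 1 : ℕ) * Real.exp t) -
            Real.exp (-t / 2) * ∑' n : ℕ, φ ((n + 1 : ℕ) * Real.exp (-t))) : ℝ) : ℂ) else 0) ∧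
        ∫ t, ‖v t‖ ^ 2 = (1 : ℝ)
    let IsTest : ℝ → (ℝ → ℂ) → Prop := fun a h =>
      IsWeilTest h ∧ tsupport h ⊆ Icc (-a) a ∧ (∀ t, h (-t) = -h t) ∧ ∫ t, ‖h t‖ ^ 2 = (1 : ℝ)
    let IsELB : ℝ → (ℝ → ℂ) → ℝ → Prop := fun a w R =>
      ∀ g : ℕ → ℝ → ℂ, (∀ n, IsTest a (g n)) →
        Tendsto (fun n => ∫ t, ‖g n t - w t‖ ^ 2) atTop (𝓝 0) →
          ∀ δ : ℝ, 0 < δ → ∀ᶠ n in atTop, R - δ ≤ (weilQuadratic (g n)).re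
    let Tight : ℝ → ℝ → ℕ → ℝ → Prop := fun θ₀ Δ₀ K a =>
      0 < weilOddGroundEnergy a ∧
      ∃ v : Fin K → ℝ → ℂ, (∀ i : Fin K, IsVec a ((i : ℕ) + 1) (v i)) ∧
        (∀ R : ℝ, (∀ c : Fin K → ℂ, (∫ t, ‖∑ i, c i * v i t‖ ^ 2 = (1 : ℝ)) →
            IsELB a (fun t => ∑ i, c i * v i t) R) →
          ∀ h : ℝ → ℂ, IsTest a h → R / (1 + θ₀) ≤ (weilQuadratic h).re) ∧
        (∃ z : ℝ → ℂ, MemLp z 2 ∧ ∀ h : ℝ → ℂ, IsTest a h →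
          ∫ t, (starRingEnd ℂ) (z t) * h t = 0 →
            (1 + Δ₀ * Real.exp (4 * a)) * weilOddGroundEnergy a ≤ (weilQuadratic h).re)
    (∀ (a : ℝ) (u : ℝ → ℂ), IsWeilOddGroundState a u →
      ∀ m₂ : ℝ, weilOddGroundEnergy a < m₂ →
        (∀ h : ℝ → ℂ, IsWeilTest h → tsupport h ⊆ Icc (-a) a → (∀ t, h (-t) = -h t) →
          ∫ t, ‖h t‖ ^ 2 = (1 : ℝ) → ∫ t, (starRingEnd ℂ) (u t) * h t = 0 →
            m₂ ≤ (weilQuadratic h).re) →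
        ∀ v : ℝ → ℂ, IsWeilTest v → tsupport v ⊆ Icc (-a) a → (∀ t, v (-t) = -v t) →
          ∫ t, ‖v t‖ ^ 2 = (1 : ℝ) →
            1 - ‖∫ t, (starRingEnd ℂ) (u t) * v t‖ ^ 2 ≤
              ((weilQuadratic v).re - weilOddGroundEnergy a) / (m₂ - weilOddGroundEnergy a)) →
    (∀ (θ₀ Δ₀ : ℝ) (K : ℕ) (a : ℝ) (u : ℝ → ℂ), 0 < θ₀ → 0 < Δ₀ → Tight θ₀ Δ₀ K a →
      IsWeilOddGroundState a u →
        ∃ v : Fin K → ℝ → ℂ, (∀ i : Fin K, IsVec a ((i : ℕ) + 1) (v i)) ∧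
          ∃ c : Fin K → ℂ, (∫ t, ‖∑ i, c i * v i t‖ ^ 2 = (1 : ℝ)) ∧
            1 - ‖∫ t, (starRingEnd ℂ) (u t) * ∑ i, c i * v i t‖ ^ 2 ≤
              2 * θ₀ * Real.exp (-4 * a) / Δ₀) →
    ∀ K : ℕ, 1 ≤ K → ∀ θ₀ : ℝ, 0 < θ₀ → ∀ Δ₀ : ℝ, 0 < Δ₀ → ∀ r : ℝ, 0 < r → ∃ A : ℝ,
      ∀ a : ℝ, A ≤ a → (∀ n : ℕ, 2 ≤ n → r * Real.exp (-2 * a) ≤ |a - Real.log n|) →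
        Tight θ₀ Δ₀ K a →
          ∃ u : ℝ → ℂ, IsWeilOddGroundState a u ∧
            ∀ᵐ t : ℝ, t ∈ Ioo 0 a → (u t).im = 0 ∧ 0 ≤ (u t).re := by
  sorry

/-- **Stub K1 — `Tight` eventually at non-resonant heights (RH-STRENGTH; the card's transfer statement C⁺,
v2 form).** There are `K ≥ 1`, `θ, Δ, r > 0` and a height `A₁` such that every window `a ≥ A₁` at distance
`≥ r e^{-2a}` from `log ℕ_{≥2}` has (o) `ε_od(a) > 0`, (i) an odd prolate block of size `K` whose every
admissible energy lower bound `R` satisfies `R ≤ (1+θe^{-4a})·Re Q(h)` on the odd unit test sphere (relative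
tightness `μ₁(K) ≤ (1+θe^{-4a})ε_od(a)`), and (ii') a relative odd gap `Δ` in codimension one. It implies RH
(`riemannHypothesis_of_stubs`); it is not known to follow from RH; lead's numerics (card falsifier (iii), folder
`num/`): `μ₁(K)/ε_od − 1 ≈ 0.11–0.19 (K=1), 0.03–0.06 (K=2), 0.02–0.055 (K=3)` on `a ∈ [0.5, 0.75]` with no
`e^{-4a}` decay — see NOTES.md / evidence. -/
theorem stub_tightBlockEventually :
    let IsSincEigen : ℝ → ℕ → (ℝ → ℝ) → ℝ → Prop := fun c k ψ μ =>
      ContinuousOn ψ (Icc (-1) 1) ∧ (∀ x, ψ (-x) = ψ x) ∧ (∫ x in Icc (-1 : ℝ) 1, ψ x ^ 2 = 1) ∧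
        (∀ x ∈ Icc (-1 : ℝ) 1, ∫ y in Icc (-1 : ℝ) 1,
          (if x = y then c / Real.pi else Real.sin (c * (x - y)) / (Real.pi * (x - y))) * ψ y =
            μ * ψ x) ∧
        {x : ℝ | x ∈ Ioo (0 : ℝ) 1 ∧ ψ x = 0}.ncard = k ∧ {x : ℝ | x ∈ Ioo (0 : ℝ) 1 ∧ ψ x = 0}.Finite
    let IsSeed : ℝ → ℕ → (ℝ → ℝ) → Prop := fun lam m φ =>
      ∃ (ψ₁ ψ : ℝ → ℝ) (μ₁ μ : ℝ), IsSincEigen (2 * Real.pi * lam ^ 2) 1 ψ₁ μ₁ ∧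
        IsSincEigen (2 * Real.pi * lam ^ 2) (2 * m + 1) ψ μ ∧
        ∀ y, φ y = if |y| ≤ lam then ψ (y / lam) * ψ₁ 0 - ψ₁ (y / lam) * ψ 0 else 0
    let IsVec : ℝ → ℕ → (ℝ → ℂ) → Prop := fun a m v =>
      ∃ (φ : ℝ → ℝ) (N : ℝ), IsSeed (Real.exp a) m φ ∧ 0 < N ∧ MemLp v 2 ∧
        (∀ t, v t = if |t| ≤ a then
          (((N / 2) * (Real.exp (t / 2) * ∑' n : ℕ, φ ((n + 1 : ℕ) * Real.exp t) -
            Real.exp (-t / 2) * ∑' n : ℕ, φ ((n + 1 : ℕ) * Real.exp (-t))) : ℝ) : ℂ) else 0) ∧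
        ∫ t, ‖v t‖ ^ 2 = (1 : ℝ)
    let IsTest : ℝ → (ℝ → ℂ) → Prop := fun a h =>
      IsWeilTest h ∧ tsupport h ⊆ Icc (-a) a ∧ (∀ t, h (-t) = -h t) ∧ ∫ t, ‖h t‖ ^ 2 = (1 : ℝ)
    let IsELB : ℝ → (ℝ → ℂ) → ℝ → Prop := fun a w R =>
      ∀ g : ℕ → ℝ → ℂ, (∀ n, IsTest a (g n)) →
        Tendsto (fun n => ∫ t, ‖g n t - w t‖ ^ 2) atTop (𝓝 0) →
          ∀ δ : ℝ, 0 < δ → ∀ᶠ n in atTop, R - δ ≤ (weilQuadratic (g n)).re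
    let Tight : ℝ → ℝ → ℕ → ℝ → Prop := fun θ₀ Δ₀ K a =>
      0 < weilOddGroundEnergy a ∧
      ∃ v : Fin K → ℝ → ℂ, (∀ i : Fin K, IsVec a ((i : ℕ) + 1) (v i)) ∧
        (∀ R : ℝ, (∀ c : Fin K → ℂ, (∫ t, ‖∑ i, c i * v i t‖ ^ 2 = (1 : ℝ)) →
            IsELB a (fun t => ∑ i, c i * v i t) R) →
          ∀ h : ℝ → ℂ, IsTest a h → R / (1 + θ₀) ≤ (weilQuadratic h).re) ∧
        (∃ z : ℝ → ℂ, MemLp z 2 ∧ ∀ h : ℝ → ℂ, IsTest a h →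
          ∫ t, (starRingEnd ℂ) (z t) * h t = 0 →
            (1 + Δ₀ * Real.exp (4 * a)) * weilOddGroundEnergy a ≤ (weilQuadratic h).re)
    ∃ K : ℕ, 1 ≤ K ∧ ∃ θ₀ : ℝ, 0 < θ₀ ∧ ∃ Δ₀ : ℝ, 0 < Δ₀ ∧ ∃ r : ℝ, 0 < r ∧ ∃ A₁ : ℝ,
      ∀ a : ℝ, A₁ ≤ a → (∀ n : ℕ, 2 ≤ n → r * Real.exp (-2 * a) ≤ |a - Real.log n|) →
        Tight θ₀ Δ₀ K a := by
  sorry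

/-- **The crux from the stubs (kernel-checked composition).** Given a height `B`: K1 supplies
`(K, θ, Δ, r, A₁)`; the shape theorem K2b (fed with the landed two-level proximity P1 and with K2a) supplies
`A`; a non-resonant window `a ≥ max B (max A A₁)` exists (P3, landed); it is tight (K1), hence good (K2b). -/
theorem OddOneSignedWindows_of : OddOneSignedWindows := by
  rw [oddOneSignedWindows_iff]
  intro B
  obtain ⟨K, hK, θ₀, hθ₀, Δ₀, hΔ₀, r, hr, A₁, htight⟩ := stub_tightBlockEventually
  obtain ⟨A, hshape⟩ := stub_signFromEnergy stub_twoLevelProximity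
    (proximityOfTight_v4 stub_twoLevelProximity) K hK θ₀ hθ₀ Δ₀ hΔ₀ r hr
  obtain ⟨a, ha, hnr⟩ := stub_nonResonantCofinal r hr (max B (max A A₁))
  have hBa : B ≤ a := le_trans (le_max_left _ _) ha
  have hAa : A ≤ a := le_trans (le_trans (le_max_left _ _) (le_max_right _ _)) ha
  have hA₁a : A₁ ≤ a := le_trans (le_trans (le_max_right _ _) (le_max_right _ _)) ha
  exact ⟨a, hBa, hshape a hAa hnr (htight a hA₁a hnr)⟩

/-- **Strength certificate of the line: K1 ⇒ RH** (modulo the landed P3). At the cofinal non-resonant heights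
of P3, clause (o) of `Tight` gives `ε_od > 0`; `ε_od` is non-increasing (`weilOddGroundEnergy_antitone`), so
`ε_od ≥ 0` at every window, which is RH by the landed odd criterion
`riemannHypothesis_iff_forall_weilOddGroundEnergy_nonneg`. (Clause (i) alone already forces `ε_od ≥ 0`:
`stub_tightBlockNonneg` / `weilOddGroundEnergy_nonneg_of_forall_div_le`, landed.) -/
theorem riemannHypothesis_of_stubs : _root_.RiemannHypothesis := by
  rw [riemannHypothesis_iff_forall_weilOddGroundEnergy_nonneg]
  intro b hb
  obtain ⟨K, -, θ, -, Δ, -, r, hr, A₁, htight⟩ := stub_tightBlockEventually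
  obtain ⟨a, ha, hnr⟩ := stub_nonResonantCofinal r hr (max b A₁)
  have hba : b ≤ a := le_trans (le_max_left _ _) ha
  have hA₁a : A₁ ≤ a := le_trans (le_max_right _ _) ha
  have h0 : 0 < weilOddGroundEnergy a := (htight a hA₁a hnr).1
  exact h0.le.trans (weilOddGroundEnergy_antitone hb hba)

end Summit.RiemannHypothesis.RiemannHypothesis.Theorems.OddSector

end
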